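import Mathlib.Combinatorics.SimpleGraph.Acyclic
import Literature.AnabelianGeometry.SemiGraphs.EmbeddingCriterion
import Literature.AnabelianGeometry.SemiGraphs.SubdivisionLemmas
import Literature.AnabelianGeometry.SemiGraphs.ZariskiMainTheorem

/-!
# Proof of [SemiAnbd] Proposition 1.1: an immersion of a connected graph into a tree is an embedding

Mochizuki, *Semi-graphs of anabelioids*, Publ. RIMS **42** (2006) 221–322, §1, Proposition 1.1,
author's manuscript p. 14 [cite: MochizukiSemiAnbd2006, Prop. 1.1 p.14]: "Any immersion from a
connected graph into a tree is, in fact, an embedding.  Proof. … If `φ` is injective on vertices, then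
it follows from the definition of an immersion that `φ` is injective on edges, hence that `φ` is an
embedding. … Suppose that there exist distinct vertices `v₁, v₂` of `G_A` that map to the same vertex
`w` of `G_B`.  Write `γ_A` for a path on `G_A` that connects `v₁` to `v₂` … of minimal length among
paths on `G_A` that join distinct vertices of `G_A` that map to the same vertex of `G_B` … the
minimality condition (together with the fact that `φ` is an immersion) implies that `γ_B` does not
intersect itself.  Thus, `γ_B` is a loop … But this contradicts the fact that `G_B` is a tree."

This file DISCHARGES the named fact `SemiGraph.immersion_into_tree_isEmbedding` of
`ZariskiMainTheorem.lean` (statement by abc-iut-L3-t1) along the printed argument, run on the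
barycentric subdivisions (`SemiGraph.subdivision`, through which `IsConnected` / `IsTree` are
defined): the node map of `φ` is a graph homomorphism (`subdivision_adj_map`, abc-iut-L3-t6) which is
*locally injective* because `φ` is an immersion; a locally injective homomorphism from a preconnected
graph to an acyclic graph is injective (`hom_injective_of_locallyInjective`, the minimal-length
argument of the printed proof, concluded with uniqueness of paths in acyclic graphs); injectivity on
vertices and edges then gives an embedding by `isEmbedding_of_injective_of_isGraph`.  Proof-only.
-/

namespace Literature.AnabelianGeometry.SemiGraphs

namespace SemiGraph

open CategoryTheory

universe u

/-- The graph-theoretic heart of [SemiAnbd] Prop. 1.1 (p. 14): a homomorphism of simple graphs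
`f : G → T` from a preconnected graph to an acyclic graph which is *locally injective* (injective on
the neighbours of every vertex) is injective.  (Minimal-length argument of the printed proof: a
shortest walk joining two distinct vertices with the same image maps to a closed walk meeting itself
only at its ends, i.e. to two distinct paths with the same ends in `T`.)
[cite: MochizukiSemiAnbd2006, Prop. 1.1 p.14] -/
theorem hom_injective_of_locallyInjective {V W : Type*} {G : SimpleGraph V} {T : SimpleGraph W}
    (f : G →g T) (hG : G.Preconnected) (hT : T.IsAcyclic)
    (hloc : ∀ ⦃x y z : V⦄, G.Adj x y → G.Adj x z → f y = f z → y = z) :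
    Function.Injective f := by
  classical
  intro x₀ y₀ hf₀
  by_contra hne₀
  -- walks joining distinct vertices with the same image exist; take one of minimal length `n`
  have hex : ∃ n : ℕ, ∃ (x y : V) (p : G.Walk x y), x ≠ y ∧ f x = f y ∧ p.length = n := by
    obtain ⟨p⟩ := hG x₀ y₀
    exact ⟨_, x₀, y₀, p, hne₀, hf₀, rfl⟩
  obtain ⟨x, y, p, hne, hfxy, hlen⟩ := Nat.find_spec hex
  have hmin : ∀ (x' y' : V) (q : G.Walk x' y'), x' ≠ y' → f x' = f y' →
      Nat.find hex ≤ q.length :=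
    fun x' y' q hne' hf' => Nat.find_min' hex ⟨x', y', q, hne', hf', rfl⟩
  set n := Nat.find hex with hn
  have hx0 : p.getVert 0 = x := p.getVert_zero
  have hxn : p.getVert n = y := by rw [← hlen]; exact p.getVert_length
  -- `n ≥ 2`: `n = 0` would give `x = y`, `n = 1` adjacent vertices with the same image
  have h2 : 2 ≤ n := by
    by_contra hlt
    rcases Nat.lt_succ_iff.1 (lt_of_not_ge hlt) |>.lt_or_eq with h0 | h1
    · exact hne (p.eq_of_length_eq_zero (by omega))
    · have hadj : G.Adj x y := by
        have h := p.adj_getVert_succ (i := 0) (by omega)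
        rwa [hx0, show 0 + 1 = n by omega, hxn] at h
      exact (f.map_adj hadj).ne hfxy
  -- no vertex of `p` repeats (splicing would give a shorter walk from `x` to `y`)
  have hsplice : ∀ i j, i < j → j ≤ n → p.getVert i ≠ p.getVert j := by
    intro i j hij hjn heq
    let q : G.Walk x y := (p.take i).append ((p.drop j).copy heq.symm rfl)
    have hq : q.length = i + (n - j) := by
      simp only [q, SimpleGraph.Walk.length_append, SimpleGraph.Walk.take_length,
        SimpleGraph.Walk.length_copy, SimpleGraph.Walk.drop_length, hlen]
      omega
    have := hmin x y q hne hfxy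
    omega
  -- `f` is injective on the vertices of `p`, except possibly for the pair of ends
  have hINJ : ∀ i j, i ≤ j → j ≤ n → ¬ (i = 0 ∧ j = n) →
      f (p.getVert i) = f (p.getVert j) → i = j := by
    intro i j hij hjn hcorner hfij
    by_contra hne'
    have hij' : i < j := lt_of_le_of_ne hij hne'
    have hend : (p.drop i).getVert (j - i) = p.getVert j := by
      rw [SimpleGraph.Walk.drop_getVert]
      congr 1
      omega
    let q : G.Walk (p.getVert i) (p.getVert j) := ((p.drop i).take (j - i)).copy rfl hend
    have hq : q.length = j - i := by
      simp only [q, SimpleGraph.Walk.length_copy, SimpleGraph.Walk.take_length,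
        SimpleGraph.Walk.drop_length, hlen]
      omega
    have := hmin _ _ q (hsplice i j hij' hjn) hfij
    omega
  -- the neighbours of the ends along `p`
  have hadj1 : G.Adj (p.getVert 1) x := by
    have h := p.adj_getVert_succ (i := 0) (by omega)
    rw [hx0] at h
    exact h.symm
  have hadj2 : G.Adj (p.getVert (n - 1)) y := by
    have h := p.adj_getVert_succ (i := n - 1) (by omega)
    rwa [show n - 1 + 1 = n by omega, hxn] at h
  by_cases hA : f (p.getVert 1) = f (p.getVert (n - 1))
  · -- then `n = 2` and `x`, `y` are neighbours of the same vertex with the same image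
    have hn2 : n = 2 := by
      by_contra hn2
      have := hINJ 1 (n - 1) (by omega) (by omega) (by omega) hA
      omega
    rw [show n - 1 = 1 by omega] at hadj2
    exact hne (hloc hadj1 hadj2 hfxy)
  · -- two distinct paths in `T` from `f (p.getVert 1)` to `f y`: the edge, and the image of `p.drop 1`
    have hedge : T.Adj (f (p.getVert 1)) (f y) := by rw [← hfxy]; exact f.map_adj hadj1
    let P1 : T.Walk (f (p.getVert 1)) (f y) := SimpleGraph.Walk.cons hedge SimpleGraph.Walk.nil
    have hP1 : P1.IsPath := by
      refine (SimpleGraph.Walk.cons_isPath_iff _ _).2 ⟨SimpleGraph.Walk.IsPath.nil, ?_⟩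
      simpa using hedge.ne
    let P2 : T.Walk (f (p.getVert 1)) (f y) := (p.drop 1).map f
    have hP2 : P2.IsPath := by
      rw [← SimpleGraph.Walk.IsPath.getVert_injOn_iff]
      intro i hi j hj hfij
      simp only [Set.mem_setOf_eq, P2, SimpleGraph.Walk.length_map,
        SimpleGraph.Walk.drop_length, hlen] at hi hj
      simp only [P2, SimpleGraph.Walk.getVert_map, SimpleGraph.Walk.drop_getVert] at hfij
      rcases le_total i j with h | h
      · have := hINJ (1 + i) (1 + j) (by omega) (by omega) (by omega) hfij
        omega
      · have := hINJ (1 + j) (1 + i) (by omega) (by omega) (by omega) hfij.symm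
        omega
    have huniq := hT.path_unique ⟨P1, hP1⟩ ⟨P2, hP2⟩
    have hl : P1.length = P2.length := by rw [Subtype.mk.inj huniq]
    simp only [P1, P2, SimpleGraph.Walk.length_cons, SimpleGraph.Walk.length_nil,
      SimpleGraph.Walk.length_map, SimpleGraph.Walk.drop_length, hlen] at hl
    apply hA
    rw [show n - 1 = 1 by omega]

/-- DISCHARGE of `immersion_into_tree_isEmbedding` ([SemiAnbd] Proposition 1.1): "Any immersion from
a connected graph into a tree is, in fact, an embedding." [cite: MochizukiSemiAnbd2006, Prop. 1.1 p.14] -/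
theorem immersion_into_tree_isEmbedding_holds : immersion_into_tree_isEmbedding.{u} := by
  intro A B φ hAg hAc hBt hφ
  -- the node map of `φ` on barycentric subdivisions, a graph homomorphism
  let f : A.subdivision →g B.subdivision :=
    ⟨Sum.map φ.vertexMap (Sum.map φ.edgeMap φ.branchMap), fun h => subdivision_adj_map φ h⟩
  -- it is locally injective because `φ` is an immersion
  have hloc : ∀ ⦃x y z : A.Node⦄, A.subdivision.Adj x y → A.subdivision.Adj x z → f y = f z →
      y = z := by
    intro x y z hy hz hyz
    change Sum.map φ.vertexMap (Sum.map φ.edgeMap φ.branchMap) y =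
      Sum.map φ.vertexMap (Sum.map φ.edgeMap φ.branchMap) z at hyz
    rcases x with v | e | b
    · obtain ⟨b₁, hb₁, rfl⟩ := (A.subdivision_adj_inl_iff v y).1 hy
      obtain ⟨b₂, hb₂, rfl⟩ := (A.subdivision_adj_inl_iff v z).1 hz
      have h : φ.branchMap b₁ = φ.branchMap b₂ := by simpa using hyz
      have := hφ v (a₁ := ⟨b₁, hb₁⟩) (a₂ := ⟨b₂, hb₂⟩) (Subtype.ext h)
      rw [Subtype.mk.injEq] at this
      rw [this]
    · obtain ⟨b₁, hb₁, rfl⟩ := (A.subdivision_adj_edge_iff e y).1 hy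
      obtain ⟨b₂, hb₂, rfl⟩ := (A.subdivision_adj_edge_iff e z).1 hz
      have h : φ.branchMap b₁ = φ.branchMap b₂ := by simpa using hyz
      rw [φ.branchMap_injOn b₁ b₂ (hb₁.trans hb₂.symm) h]
    · rcases (A.subdivision_adj_branch_iff b y).1 hy with rfl | ⟨v₁, hv₁, rfl⟩ <;>
        rcases (A.subdivision_adj_branch_iff b z).1 hz with rfl | ⟨v₂, hv₂, rfl⟩
      · rfl
      · simp at hyz
      · simp at hyz
      · rw [hv₁] at hv₂
        cases hv₂
        rfl
  have hinj := hom_injective_of_locallyInjective f hAc.connected.preconnected hBt.isTree.isAcyclic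
    hloc
  refine isEmbedding_of_injective_of_isGraph φ hAg (fun v₁ v₂ h => ?_) (fun e₁ e₂ h => ?_)
  · have := @hinj (Sum.inl v₁) (Sum.inl v₂) (by simp [f, h])
    simpa using this
  · have := @hinj (Sum.inr (Sum.inl e₁)) (Sum.inr (Sum.inl e₂)) (by simp [f, h])
    simpa using this

end SemiGraph

end Literature.AnabelianGeometry.SemiGraphs
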